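import Mathlib
import HarnessLib
import HarnessLib.Audit
import Summits.Langlands.Langlands.Theorems.JDegreeFilterSplit

import Summits.Langlands.Langlands.Theorems.DyadicDoorSplitPrelude

/-!
# DyadicDoorSplit (main) — lens-5 g28 node on LJR = `JDegreeFilterSplit.LargeJResidual`
Census-twin landing of `HOME/nodes/lens-5-g28-DyadicDoorSplit.lean` (sha256 5d8e3514c860…, 513 l), SPLIT VERBATIM at §5 into two Theorems files for the
gate's 400-line lint (census-1 g30; crit-1 g9 CLEARED row 414, no conditions); one namespace, bodies concatenating to the node body; no text changed.
This part covers §5–§6 (orbit closure of the dial under totally real base change).  The full module docstring of the node is kept in the Prelude.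
-/

set_option linter.dupNamespace false
set_option linter.unusedVariables false

open scoped NumberField IntermediateField
open NumberField IsDedekindDomain Literature.NumberTheory.Automorphic
open Summit.Langlands.Langlands.Theorems.DepthIsolationSplit (UnanchoredBox UnanchoredHighDegreeModularE
  IntegralModelTransferPointwise SatakeAvatarTwo satakeAvatarTwo_of_host)
open Summit.Langlands.Langlands.Theorems.JDegreeFilterSplit (jInv jDeg InResidualRange LargeJResidual
  RatBaseChangeModularity SmallFieldBaseChange restE_of_jLeaves rest_of_restE largeJResidual_of_restE
  jInv_baseChange algebraMap_baseChange_Δ)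

namespace Summit.Langlands.Langlands.Theorems.DyadicDoorSplit

/-! ## §5 Bridge: orbit closure of the dial under totally real base change -/

/-- The discriminant of a base change is the image of the discriminant. -/
theorem disc_baseChange (F K : Type) [Field F] [NumberField F] [Field K] [NumberField K] [Algebra F K]
    (E₀ : WeierstrassCurve (𝓞 F)) : disc K (E₀.baseChange (𝓞 K)) = algebraMap F K (disc F E₀) := by
  unfold disc
  exact algebraMap_baseChange_Δ F K E₀

/-- An element negative at some real place is not a square. -/
theorem not_isSquare_of_realEmbedding_neg {K₀ : Type} [Field K₀] (x : K₀) (σ : K₀ →+* ℝ)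
    (h : σ x < 0) : ¬ IsSquare x := by
  rintro ⟨a, rfl⟩
  rw [map_mul] at h
  exact absurd h (not_lt.2 (mul_self_nonneg (σ a)))

/-- Real places extend along totally real extensions: every real embedding of `F` is the restriction of a
real embedding of any totally real finite extension `K / F`. -/
theorem exists_realEmbedding_extends (F K : Type) [Field F] [NumberField F] [Field K] [NumberField K]
    [Algebra F K] [IsTotallyReal K] (σ : F →+* ℝ) :
    ∃ τ : K →+* ℝ, τ.comp (algebraMap F K) = σ := by
  let φ₀ : F →+* ℂ := (algebraMap ℝ ℂ).comp σ
  letI : Algebra F ℂ := φ₀.toAlgebra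
  haveI : Module.Finite F K := Module.Finite.of_restrictScalars_finite ℚ F K
  let ψ : K →ₐ[F] ℂ := IsAlgClosed.lift
  have hψ : ComplexEmbedding.IsReal ψ.toRingHom := IsTotallyReal.complexEmbedding_isReal _
  refine ⟨hψ.embedding, ?_⟩
  ext x
  apply Complex.ofReal_injective
  rw [RingHom.comp_apply, ComplexEmbedding.IsReal.coe_embedding_apply]
  change ψ (algebraMap F K x) = φ₀ x
  rw [AlgHom.commutes]
  rfl

/-- SIGN PERSISTENCE: if `Δ(E₀)` is negative at some real place of `F`, then `Δ(E₀ ⊗ K)` is negative at some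
real place of every totally real extension `K / F`. -/
theorem discNeg_baseChange (F K : Type) [Field F] [NumberField F] [Field K] [NumberField K]
    [Algebra F K] [IsTotallyReal K] (E₀ : WeierstrassCurve (𝓞 F))
    (h : ∃ σ : F →+* ℝ, σ (disc F E₀) < 0) :
    ∃ τ : K →+* ℝ, τ (disc K (E₀.baseChange (𝓞 K))) < 0 := by
  obtain ⟨σ, hσ⟩ := h
  obtain ⟨τ, hτ⟩ := exists_realEmbedding_extends F K σ
  refine ⟨τ, ?_⟩
  rw [disc_baseChange, ← RingHom.comp_apply, hτ]
  exact hσ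

/-- The same for a positive real place. -/
theorem discPos_baseChange (F K : Type) [Field F] [NumberField F] [Field K] [NumberField K]
    [Algebra F K] [IsTotallyReal K] (E₀ : WeierstrassCurve (𝓞 F))
    (h : ∃ σ : F →+* ℝ, 0 < σ (disc F E₀)) :
    ∃ τ : K →+* ℝ, 0 < τ (disc K (E₀.baseChange (𝓞 K))) := by
  obtain ⟨σ, hσ⟩ := h
  obtain ⟨τ, hτ⟩ := exists_realEmbedding_extends F K σ
  refine ⟨τ, ?_⟩
  rw [disc_baseChange, ← RingHom.comp_apply, hτ]
  exact hσ

/-- ORBIT CLOSURE of (b₂): a discriminant negative at some real place stays a NON-SQUARE over every totally real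
extension — the sub-locus R_sq is unreachable from the mixed-sign / totally negative locus by base change. -/
theorem discNonsquare_baseChange_of_neg (F K : Type) [Field F] [NumberField F] [Field K] [NumberField K]
    [Algebra F K] [IsTotallyReal K] (E₀ : WeierstrassCurve (𝓞 F))
    (h : ∃ σ : F →+* ℝ, σ (disc F E₀) < 0) : DiscNonsquare K (E₀.baseChange (𝓞 K)) := by
  obtain ⟨τ, hτ⟩ := discNeg_baseChange F K E₀ h
  exact not_isSquare_of_realEmbedding_neg _ τ hτ

/-- ORBIT CLOSURE of (c): over a totally real extension of a field where `Δ` is positive at some real place,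
`Δ` is not totally negative, so Allen's condition (c) holds vacuously. -/
theorem allenConditionC_baseChange_of_pos (F K : Type) [Field F] [NumberField F] [Field K] [NumberField K]
    [Algebra F K] [IsTotallyReal K] (E₀ : WeierstrassCurve (𝓞 F))
    (h : ∃ σ : F →+* ℝ, 0 < σ (disc F E₀)) : AllenConditionC K (E₀.baseChange (𝓞 K)) := by
  intro hneg
  obtain ⟨τ, hτ⟩ := discPos_baseChange F K E₀ h
  exact absurd (hneg τ) (not_lt.2 hτ.le)

/-- ORBIT CLOSURE of (a): `v(j) ≤ 0` at the dyadic places persists under every base change (the valuation at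
a place `w ∣ v` is the `e(w|v)`-th power of the valuation at `v`, Mathlib `valuation_liesOver`). -/
theorem jNonposAtTwo_baseChange (F K : Type) [Field F] [NumberField F] [Field K] [NumberField K]
    [Algebra F K] (E₀ : WeierstrassCurve (𝓞 F)) (h : JNonposAtTwo F E₀) :
    JNonposAtTwo K (E₀.baseChange (𝓞 K)) := by
  intro w hw
  have h2u : (2 : 𝓞 F) ∈ w.asIdeal.under (𝓞 F) := by
    rw [Ideal.under_def, Ideal.mem_comap, map_ofNat]; exact hw
  have hne : w.asIdeal.under (𝓞 F) ≠ ⊥ := by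
    intro hbot
    rw [hbot, Ideal.mem_bot] at h2u
    exact two_ne_zero h2u
  let v : HeightOneSpectrum (𝓞 F) := ⟨w.asIdeal.under (𝓞 F), inferInstance, hne⟩
  haveI : w.asIdeal.LiesOver v.asIdeal := ⟨rfl⟩
  have hj : jInv K (E₀.baseChange (𝓞 K)) = algebraMap F K (jInv F E₀) := jInv_baseChange F K E₀
  rw [hj, ← IsDedekindDomain.HeightOneSpectrum.valuation_liesOver K v w (jInv F E₀)]
  exact one_le_pow_of_one_le' (h v h2u) _

/-! ## §6 Bridge (continued): no `2`-torsion is acquired in a totally real extension when `Δ` is negative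
somewhere — the cubic field `F(x₁)` then has a complex place, so it lies in no totally real field -/

/-- The `2`-division cubic commutes with base change. [folklore] -/
theorem twoTorsionPolynomial_map {R S : Type} [CommRing R] [CommRing S] (W : WeierstrassCurve R)
    (φ : R →+* S) : (W.map φ).twoTorsionPolynomial = W.twoTorsionPolynomial.map φ := by
  simp only [WeierstrassCurve.twoTorsionPolynomial, Cubic.map, WeierstrassCurve.map_b₂,
    WeierstrassCurve.map_b₄, WeierstrassCurve.map_b₆, map_ofNat, map_mul]

/-- The generic fibre of the base-changed integral model is the base change of the generic fibre. -/
theorem baseChange_baseChange_eq_map (F K : Type) [Field F] [NumberField F] [Field K] [NumberField K]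
    [Algebra F K] (E₀ : WeierstrassCurve (𝓞 F)) :
    (E₀.baseChange (𝓞 K)).baseChange K = (E₀.baseChange F).map (algebraMap F K) := by
  simp only [WeierstrassCurve.baseChange, WeierstrassCurve.map_map, ← IsScalarTower.algebraMap_eq]

/-- A real cubic with leading coefficient of real image whose discriminant is NEGATIVE at the real embedding
`σ` has a non-real complex root (all roots real ⟹ discriminant = square of a real number ≥ 0). -/
theorem exists_nonreal_root_of_discr_neg {F : Type} [Field F] (P : Cubic F) (ha : P.a ≠ 0)
    (σ : F →+* ℝ) (hneg : σ P.discr < 0) :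
    ∃ z : ℂ, z ∈ (Cubic.map (Complex.ofRealHom.comp σ) P).roots ∧ z.im ≠ 0 := by
  set φ₀ : F →+* ℂ := Complex.ofRealHom.comp σ with hφ₀
  obtain ⟨a, b, c, h3⟩ := (Cubic.splits_iff_roots_eq_three ha).1 (IsAlgClosed.splits (P.toPoly.map φ₀))
  have hdisc := Cubic.discr_eq_prod_three_roots ha h3
  by_contra hall
  push Not at hall
  have ha0 : a.im = 0 := hall a (by rw [h3]; simp)
  have hb0 : b.im = 0 := hall b (by rw [h3]; simp)
  have hc0 : c.im = 0 := hall c (by rw [h3]; simp)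
  have hPa : (φ₀ P.a).im = 0 := by rw [hφ₀, RingHom.comp_apply]; exact Complex.ofReal_im _
  set w : ℂ := φ₀ P.a * φ₀ P.a * (a - b) * (a - c) * (b - c) with hw
  have hwim : w.im = 0 := by
    simp only [hw, Complex.mul_im, Complex.sub_im, Complex.sub_re, ha0, hb0, hc0, hPa, mul_zero, zero_mul,
      add_zero, sub_self]
  have hre : (φ₀ P.discr).re = σ P.discr := by rw [hφ₀, RingHom.comp_apply]; exact Complex.ofReal_re _
  have hnonneg : 0 ≤ (φ₀ P.discr).re := by
    rw [hdisc, pow_two, Complex.mul_re, hwim, mul_zero, sub_zero]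
    exact mul_self_nonneg _
  rw [hre] at hnonneg
  exact absurd hneg (not_lt.2 hnonneg)

/-- ORBIT CLOSURE of (b₁): if `E₀ / F` has no `F`-rational `2`-torsion and `Δ(E₀)` is negative at some real
place of `F`, then `E₀ ⊗ K` has no `K`-rational `2`-torsion for every TOTALLY REAL extension `K / F`
(a root `x ∈ K` of the `2`-division cubic would give an `F`-embedding `F(x) → ℂ` onto a non-real root,
extending to a non-real embedding of `K`).  Hence the sub-locus R_tors is unreachable from the mixed-sign
(or totally negative) Allen locus by totally real base change. [folklore] -/
theorem noRationalTwoTorsion_baseChange_of_neg (F K : Type) [Field F] [NumberField F] [Field K]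
    [NumberField K] [Algebra F K] [IsTotallyReal K] (E₀ : WeierstrassCurve (𝓞 F))
    (hT : NoRationalTwoTorsion F E₀) (hneg : ∃ σ : F →+* ℝ, σ (disc F E₀) < 0) :
    NoRationalTwoTorsion K (E₀.baseChange (𝓞 K)) := by
  obtain ⟨σ, hσ⟩ := hneg
  intro x hx
  -- the `2`-division cubic over `F` and its image over `K`
  set P : Cubic F := (E₀.baseChange F).twoTorsionPolynomial with hP
  have ha : P.a ≠ 0 := by rw [hP]; show (4 : F) ≠ 0; norm_num
  have hPK : ((E₀.baseChange (𝓞 K)).baseChange K).twoTorsionPolynomial.toPoly =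
      P.toPoly.map (algebraMap F K) := by
    rw [baseChange_baseChange_eq_map, twoTorsionPolynomial_map, Cubic.map_toPoly]
  rw [hPK, Polynomial.IsRoot, Polynomial.eval_map, ← Polynomial.aeval_def] at hx
  -- `P` is irreducible over `F` (a cubic with no root), hence a constant multiple of `minpoly F x`
  have hirr : Irreducible P.toPoly := by
    refine Polynomial.irreducible_of_degree_le_three_of_not_isRoot ?_ (fun y hy => hT y hy)
    rw [Cubic.natDegree_of_a_ne_zero ha]; decide
  haveI : Module.Finite F K := Module.Finite.of_restrictScalars_finite ℚ F K
  have hxint : IsIntegral F x := Algebra.IsIntegral.isIntegral x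
  have hmin : P.toPoly * Polynomial.C P.toPoly.leadingCoeff⁻¹ = minpoly F x := minpoly.eq_of_irreducible hirr hx
  -- the discriminant of `P` is `16 Δ`, negative at `σ`: pick a non-real complex root `z` of `P^σ`
  have hdiscr : P.discr = 16 * disc F E₀ := by
    rw [hP, WeierstrassCurve.twoTorsionPolynomial_discr]
    unfold disc
    rw [WeierstrassCurve.baseChange, WeierstrassCurve.map_Δ]
  have hσneg : σ P.discr < 0 := by
    rw [hdiscr, map_mul, map_ofNat]; linarith
  obtain ⟨z, hz, hzim⟩ := exists_nonreal_root_of_discr_neg P ha σ hσneg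
  -- `ℂ` as an `F`-algebra through `σ`; `z` is a root of `minpoly F x`
  set φ₀ : F →+* ℂ := Complex.ofRealHom.comp σ with hφ₀
  letI : Algebra F ℂ := φ₀.toAlgebra
  have hφalg : algebraMap F ℂ = φ₀ := RingHom.algebraMap_toAlgebra φ₀
  have hzP : Polynomial.aeval z P.toPoly = 0 := by
    rw [Cubic.map_roots, Polynomial.mem_roots (Polynomial.map_ne_zero (Cubic.ne_zero_of_a_ne_zero ha))] at hz
    rw [Polynomial.aeval_def, hφalg, ← Polynomial.eval_map]
    exact hz
  have hzmin : Polynomial.aeval z (minpoly F x) = 0 := by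
    rw [← hmin, map_mul, hzP, zero_mul]
  -- an `F`-embedding `Ψ : K → ℂ` with `Ψ x = z` (K/F algebraic, every minimal polynomial splits in `ℂ`)
  obtain ⟨Ψ, hΨx⟩ := IntermediateField.exists_algHom_of_splits_of_aeval
    (fun s : K => ⟨Algebra.IsIntegral.isIntegral s, IsAlgClosed.splits _⟩) hzmin
  -- `K` is totally real, so `Ψ` is a real embedding; but `Ψ x = z` is not real
  have hreal : ComplexEmbedding.IsReal Ψ.toRingHom := IsTotallyReal.complexEmbedding_isReal _
  have hconj := RingHom.congr_fun (ComplexEmbedding.isReal_iff.1 hreal) x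
  rw [ComplexEmbedding.conjugate_coe_eq] at hconj
  change (starRingEnd ℂ) (Ψ x) = Ψ x at hconj
  rw [hΨx, Complex.conj_eq_iff_im] at hconj
  exact hzim hconj

/-- THE ORBIT-CLOSED CORE OF THE PRINT CELL: a curve of the Allen locus whose discriminant has MIXED SIGN
(negative at one real place, positive at another) stays in the Allen locus over EVERY totally real extension —
so no totally real base change moves it into the residual; together with twist invariance (same `j`,
`Δ ↦ θ⁶ Δ`) the residual `DyadicDegenerateResidual` is strictly weaker than LJR modulo the cheap moves. -/
theorem allenLocus_baseChange_of_mixedSign (F K : Type) [Field F] [NumberField F] [Field K]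
    [NumberField K] [Algebra F K] [IsTotallyReal K] (E₀ : WeierstrassCurve (𝓞 F))
    (hL : AllenLocus F E₀) (hneg : ∃ σ : F →+* ℝ, σ (disc F E₀) < 0)
    (hpos : ∃ σ : F →+* ℝ, 0 < σ (disc F E₀)) : AllenLocus K (E₀.baseChange (𝓞 K)) :=
  ⟨jNonposAtTwo_baseChange F K E₀ hL.1, noRationalTwoTorsion_baseChange_of_neg F K E₀ hL.2.1 hneg,
    discNonsquare_baseChange_of_neg F K E₀ hneg, allenConditionC_baseChange_of_pos F K E₀ hpos⟩

end Summit.Langlands.Langlands.Theorems.DyadicDoorSplit
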